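import Summits.ABC.ABC.Theorems.IUTThetaPilotABCExpThreeDegOne
import Summits.ABC.IUTFork.LDHGenuinePerImageSufficiencyNum
import HarnessLib

/-!
# DEGREE ONE, reading (U): polynomial abc (3+ε) for ALL triples / Vojta(1+ε) at the rational points ⇐ [IUTchIII] Cor. 3.12 (U) at the
# SZPIRO-BAD admissible RATIONAL `λ` ALONE — one-hypothesis number-level tails (branch C intake, abc-iut-C-cert-3 gen 2)

PROOF-ONLY (no `def`, no new `Prop`; nothing re-typed). At an admissible rational point (`d_mod = 1 ≤ (l+5)/4`) the Szpiro-good case of the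
number-level Corollary is abc-iut-c312-d1's THEOREM `Cor22.cor312AtDatum_of_szpiro` (`LDHGenuinePerImageSufficiencyNum`); so abc-iut-S6's
degree-one line (`ThetaPartIIDegOne.thm110LegendreUpTo_one_of_cor312_degOne` / `abc_exp_three_of_cor312_degOne`, hull-volume estimate at
`d_mod = 1` a theorem inside) and abc-iut-S2's `ThetaPartIIDisplay.vojtaIneq_two_degOne_of_cor312` need the Corollary ONLY at the SZPIRO-BAD
admissible rational data: `cor312_degOne_of_cor312Bad`, `thm110LegendreUpTo_one_of_cor312Bad_degOne`, **`abc_exp_three_of_cor312Bad_degOne`**,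
`vojtaIneq_two_degOne_of_cor312Bad` — ONE hypothesis `h312Bad₁` (the antecedent of `Cor22.forall_cor312Of_of_szpiroBad` VERBATIM, guarded by
`P.degree ≤ 1`); no Θ-datum structure, no S/S_H, no cone, and for the abc form no `K_V`. The (P)-reading twin (per-image Corollary, stronger
hypothesis) is `ThetaPartIIDegOne.abc_exp_three_of_cor312PerImage_szpiroBad_degOne`. Consumed by the Szpiro-cut degree-one certificates
`Conditional/AbcOfSGenuineMWindowDegreeOneSzpiroBad.lean`. HONEST FRAMING: conditionally verifies; nothing asserts abc, Vojta or Cor. 3.12 at any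
datum; no side taken on any author; typed ≠ proved. [claim: Mochizuki2012, status: disputed]
[cite: Mochizuki2012, IUTchIII Cor. 3.12 p. 173–174; IUTchIV Thm. 1.10 p. 22–31, Cor. 2.2 (ii)–(iii) p. 43–47, Cor. 2.3 p. 54–55]
-/

noncomputable section

open Set Function NumberField IsDedekindDomain

namespace Summit.ABC.IUTFork.Conditional

open Literature.IUT.LogVolume Literature.NumberTheory.NumberFields Literature.NumberTheory.DiophantineGeometry
open Literature.NumberTheory.DiophantineGeometry.GenEll Summit.ABC.ABC.Theorems

/-! ## §1 Number-level degree-one tails in reading (U): ONE hypothesis, at the Szpiro-bad admissible rational data -/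

/-- **Cor. 3.12 (U) at EVERY admissible rational `(P, l)` from Cor. 3.12 (U) at the SZPIRO-BAD ones**: at `P ∈ UP` of degree `≤ 1`, `l ≥ 5` prime
with the admissibility conditions, either `(P, l)` is Szpiro-good — then `Cor22.Cor312AtDatum P l` is abc-iut-c312-d1's THEOREM
`Cor22.cor312AtDatum_of_szpiro` — or it is Szpiro-bad and the hypothesis applies. [claim: Mochizuki2012, status: disputed]
[cite: Mochizuki2012, IUTchIII Cor. 3.12 p. 173–174; IUTchIV Cor. 2.2 (ii) proof p. 46] -/
theorem cor312_degOne_of_cor312Bad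
    (h312Bad₁ : ∀ P : NFPoint, P ∈ UP → P.degree ≤ 1 → ∀ l : ℕ, l.Prime → 5 ≤ l →
      Cor22.AdmitsCore P → Cor22.CondP2 P l → Cor22.CondP5 P l → Cor22.CondP6 P l →
      (((l : ℝ) + 5) / 4 < (Cor22.dmod P : ℝ) ∨
        6 * l * (((l : ℝ) + 5) - 4 * Cor22.dmod P) / (((l : ℝ) + 4) * ((l : ℝ) - 3))
            * (P.logDiff + (1 - 1 / (l : ℝ)) * Cor22.logCondAvoid P {2, l})
          + 6 * l * ((l : ℝ) + 5) / (((l : ℝ) + 4) * ((l : ℝ) - 3)) * Real.log Real.pi < Cor22.logQAvoid P {2, l}) →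
        Cor22.Cor312AtDatum P l) :
    ∀ P : NFPoint, P ∈ UP → P.degree ≤ 1 → ∀ l : ℕ, l.Prime → 5 ≤ l →
      Cor22.AdmitsCore P → Cor22.CondP2 P l → Cor22.CondP5 P l → Cor22.CondP6 P l →
        Cor22.Cor312AtDatum P l := by
  intro P hP hdeg l hl h5 hc h2 h5' h6
  by_cases hd : (Cor22.dmod P : ℝ) ≤ ((l : ℝ) + 5) / 4
  · by_cases hq : Cor22.logQAvoid P {2, l} ≤
        6 * l * (((l : ℝ) + 5) - 4 * Cor22.dmod P) / (((l : ℝ) + 4) * ((l : ℝ) - 3))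
            * (P.logDiff + (1 - 1 / (l : ℝ)) * Cor22.logCondAvoid P {2, l})
          + 6 * l * ((l : ℝ) + 5) / (((l : ℝ) + 4) * ((l : ℝ) - 3)) * Real.log Real.pi
    · exact Cor22.cor312AtDatum_of_szpiro hP.1 h5 hd hq
    · exact h312Bad₁ P hP hdeg l hl h5 hc h2 h5' h6 (Or.inr (lt_of_not_ge hq))
  · exact h312Bad₁ P hP hdeg l hl h5 hc h2 h5' h6 (Or.inl (lt_of_not_ge hd))

/-- **`Cor22.Thm110LegendreUpTo 1` ⇐ Cor. 3.12 (U) at the Szpiro-bad admissible rational data** (abc-iut-S6's `thm110LegendreUpTo_one_of_cor312_degOne`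
under the cut; the hull-volume estimate at `d_mod = 1` is a theorem inside it). CONDITIONAL; nothing asserted. [claim: Mochizuki2012, status: disputed]
[cite: Mochizuki2012, IUTchIV Thm. 1.10 proof Steps (ii)–(viii) pp. 24–31] -/
theorem thm110LegendreUpTo_one_of_cor312Bad_degOne
    (h312Bad₁ : ∀ P : NFPoint, P ∈ UP → P.degree ≤ 1 → ∀ l : ℕ, l.Prime → 5 ≤ l →
      Cor22.AdmitsCore P → Cor22.CondP2 P l → Cor22.CondP5 P l → Cor22.CondP6 P l →
      (((l : ℝ) + 5) / 4 < (Cor22.dmod P : ℝ) ∨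
        6 * l * (((l : ℝ) + 5) - 4 * Cor22.dmod P) / (((l : ℝ) + 4) * ((l : ℝ) - 3))
            * (P.logDiff + (1 - 1 / (l : ℝ)) * Cor22.logCondAvoid P {2, l})
          + 6 * l * ((l : ℝ) + 5) / (((l : ℝ) + 4) * ((l : ℝ) - 3)) * Real.log Real.pi < Cor22.logQAvoid P {2, l}) →
        Cor22.Cor312AtDatum P l) :
    Cor22.Thm110LegendreUpTo 1 :=
  ThetaPartIIDegOne.thm110LegendreUpTo_one_of_cor312_degOne (cor312_degOne_of_cor312Bad h312Bad₁)

/-- **POLYNOMIAL abc ⇐ [IUTchIII] Cor. 3.12 (reading (U)) AT THE SZPIRO-BAD ADMISSIBLE RATIONAL `λ` ALONE**: if `Cor22.Cor312AtDatum P l` holds at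
every admissible rational `λ`-line point (`P ∈ UP`, degree `≤ 1`, `l ≥ 5` prime, `AdmitsCore`, (P2), (P5), (P6)) that is SZPIRO-BAD in abc-iut-c312-d1's
sense, then for every `ε > 0` there is `C > 0` with `c < C·rad(abc)^{3+ε}` for EVERY abc triple (abc-iut-S6's `abc_exp_three_of_cor312_degOne` under
the cut). ONE hypothesis; no Θ-datum structure, no S/S_H, no cone, no `K_V`. CONDITIONAL; nothing here asserts abc or Cor. 3.12.
[claim: Mochizuki2012, status: disputed] [cite: Mochizuki2012, IUTchIII Cor. 3.12 p. 173–174; IUTchIV Thm. A, Cor. 2.2 (ii) p. 41–46] -/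
theorem abc_exp_three_of_cor312Bad_degOne
    (h312Bad₁ : ∀ P : NFPoint, P ∈ UP → P.degree ≤ 1 → ∀ l : ℕ, l.Prime → 5 ≤ l →
      Cor22.AdmitsCore P → Cor22.CondP2 P l → Cor22.CondP5 P l → Cor22.CondP6 P l →
      (((l : ℝ) + 5) / 4 < (Cor22.dmod P : ℝ) ∨
        6 * l * (((l : ℝ) + 5) - 4 * Cor22.dmod P) / (((l : ℝ) + 4) * ((l : ℝ) - 3))
            * (P.logDiff + (1 - 1 / (l : ℝ)) * Cor22.logCondAvoid P {2, l})
          + 6 * l * ((l : ℝ) + 5) / (((l : ℝ) + 4) * ((l : ℝ) - 3)) * Real.log Real.pi < Cor22.logQAvoid P {2, l}) →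
        Cor22.Cor312AtDatum P l)
    {ε : ℝ} (hε : 0 < ε) :
    ∃ C : ℝ, 0 < C ∧ ∀ a b c : ℕ, IsABCTriple a b c → (c : ℝ) < C * ((rad a b c : ℕ) : ℝ) ^ (3 + ε) :=
  ThetaPartIIDegOne.abc_exp_three_of_cor312_degOne (cor312_degOne_of_cor312Bad h312Bad₁) hε

/-- **Vojta(1+ε) at the rational points of every compactly bounded `K_V ∋ 2` ⇐ Cor. 3.12 (U) at the Szpiro-bad admissible rational data** (abc-iut-S2's
`ThetaPartIIDisplay.vojtaIneq_two_degOne_of_cor312` under the cut). ONE hypothesis. CONDITIONAL; nothing asserted. [claim: Mochizuki2012, status: disputed]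
[cite: Mochizuki2012, IUTchIV Cor. 2.2–2.3 pp. 41–55] -/
theorem vojtaIneq_two_degOne_of_cor312Bad
    (h312Bad₁ : ∀ P : NFPoint, P ∈ UP → P.degree ≤ 1 → ∀ l : ℕ, l.Prime → 5 ≤ l →
      Cor22.AdmitsCore P → Cor22.CondP2 P l → Cor22.CondP5 P l → Cor22.CondP6 P l →
      (((l : ℝ) + 5) / 4 < (Cor22.dmod P : ℝ) ∨
        6 * l * (((l : ℝ) + 5) - 4 * Cor22.dmod P) / (((l : ℝ) + 4) * ((l : ℝ) - 3))
            * (P.logDiff + (1 - 1 / (l : ℝ)) * Cor22.logCondAvoid P {2, l})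
          + 6 * l * ((l : ℝ) + 5) / (((l : ℝ) + 4) * ((l : ℝ) - 3)) * Real.log Real.pi < Cor22.logQAvoid P {2, l}) →
        Cor22.Cor312AtDatum P l)
    {ε : ℝ} (hε : 0 < ε) (D : CBData) (hD : D.SupportContains {2}) : VojtaIneq D.toSet 1 ε :=
  ThetaPartIIDisplay.vojtaIneq_two_degOne_of_cor312 (cor312_degOne_of_cor312Bad h312Bad₁) hε D hD

end Summit.ABC.IUTFork.Conditional

end
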